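import Summits.QuantumFields.BalabanUV.Beta.FP.MarginalUniqueness

/-!
# `BalabanUV.Beta.FP.MarginalUniquenessQuartic` — road «FP» for binder row D1, leaf (U4): UNIQUENESS OF THE MARGINAL QUARTIC GAUGE VERTEX
# under HYPEROCTAHEDRAL (lattice) symmetry, for colour structures in the span of the channel tensors `f^{abe}f^{cde}`, `f^{ace}f^{bde}`, `f^{ade}f^{bce}`:
# on every background `B` such a momentum-free germ IS `c · Σ_{μν} Σ_e ([B_μ,B_ν]^e)²` (the Yang–Mills quartic germ) — the would-be extra hypercubic
# invariant `Σ_μ B^a_μ B^b_μ B^c_μ B^d_μ` dies against every channel by the antisymmetry of `f`, as does every pairing aligned with the channel's own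
# colour pairing.  Finite-dimensional invariant theory over `Fin 4` × an arbitrary finite colour type; neither Jacobi nor Bose symmetry is needed.

HONEST FRAMING (cell contract, verbatim): «discharging `BetaPertH` makes Bałaban's UV stability UNCONDITIONAL — a real constructive-QFT result;
it is NOT the continuum limit and NOT the Clay problem.»  THIS MODULE DISCHARGES NOTHING of the wall: it is linear algebra.  USE: skeleton
`HOME/beta/skeletons/D1-b2b-balaban-beta-d1-p3.md` leaf N7d (U4), claim table `HOME/b2b-balaban-beta-d1-p3/LEAVES-FP.md` row U4 (unit
`b2b-balaban-beta-d1-formalise-leaf-05`); companion of `FP/MarginalUniqueness.cubic_unique` (U3) one order up.  The skeleton marks U4 OPTIONAL — the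
quartic vertex enters the one-loop polarization only through the tadpole, a local kernel with `O(1)` `μ ≠ ν` second moment, never the `log` coefficient.
ABSOLUTE RULE (cell, verbatim): «No internally-minted statement may enter as a cited fact. Every hypothesis is either kernel-proved in this package or a
verbatim quotation of a PUBLISHED theorem with page reference.»  Nothing is cited; every hypothesis is a symmetry SHAPE on an abstract coefficient table.

ENCODING.  Legs `1..4` carry (colour, vector index) `(a,μ),(b,ν),(c,λ),(d,ρ)`.  A quartic vertex with colour structure in the channel span is a triple of
LORENTZ TABLES `Q : Fin 3 → QuarticTable`, `V^{abcd}_{μνλρ} = (Σ_e f_{abe}f_{cde})·Q 0 μνλρ + (Σ_e f_{ace}f_{bde})·Q 1 μνλρ + (Σ_e f_{ade}f_{bce})·Q 2 μνλρ`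
(`vertex`), `f : C → C → C → ℝ` an ARBITRARY table of which only ANTISYMMETRY IN THE FIRST TWO SLOTS is used (`Antisym`; Jacobi only makes `Q` non-unique,
irrelevant for the value); its value on a background `B : C → Idx → ℝ` is `quarticPoly f Q B = Σ_{μνλρ} Σ_{abcd} V^{abcd}_{μνλρ}·B a μ·B b ν·B c λ·B d ρ`.
HYPOTHESES on each `Q k`: `PermInvariant₄` / `FlipInvariant₄` = invariance under `B₄` (signed permutations of the four axes), as in U3.  YANG–MILLS GERM:
`ymQuartic f B = Σ_μ Σ_ν Σ_e (cur f B e μ ν)²`, `cur f B e μ ν = Σ_{ab} f_{abe}·B a μ·B b ν` (`= [B_μ,B_ν]^e` for structure constants `f`).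
CONTENT.  §1 `quartic_classification` (a `B₄`-invariant quartic table = three pairings + hypercubic tensor, explicit coefficients); §2 `sum_table_eq` and the
CHANNEL FORMS against antisymmetric currents, `chanS T S = (T₀₁₀₁ − T₀₁₁₀)·ym S`, `chanT T S = (T₀₀₁₁ − T₀₁₁₀)·ym S`, `chanU T S = (T₀₀₁₁ − T₀₁₀₁)·ym S`;
§3 colour Fubini `quarticPoly = chanS (Q 0) cur + chanT (Q 1) cur + chanU (Q 2) cur`; §4 **`quartic_unique`**: `quarticPoly f Q B = cQ Q · ymQuartic f B`,
`quarticPoly_ymTable` (consistency, `cQ = 1` on the Yang–Mills vertex), `hypercubic_singlet_not_ym` (NECESSITY of the colour hypothesis: the `B₄`-invariant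
colour-singlet quartic `Σ_μ (Σ_a (B a μ)²)²` is not of this form).  NOT BetaPertH, NOT continuum, NOT Clay.
-/

namespace Summit.QuantumFields.BalabanUV.Beta.FP.MarginalUniquenessQuartic

open Finset
open scoped BigOperators
open Summit.QuantumFields.BalabanUV.Beta.FP.MarginalUniqueness (Idx δ δ_of_ne rs rs_self rs_of_ne δ_perm
  exists_perm_zero_one exists_perm_zero)

/-! ## 0. Encoding -/

/-- [our object] A quartic Lorentz table: `T μ ν λ ρ` = coefficient of `B¹_μ B²_ν B³_λ B⁴_ρ` (momentum-free). -/
abbrev QuarticTable := Idx → Idx → Idx → Idx → ℝ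

/-- [our object] Invariance of a quartic table under axis permutations (acting on all four vector indices). -/
def PermInvariant₄ (T : QuarticTable) : Prop :=
  ∀ (σ : Equiv.Perm Idx) (μ ν lam ρ : Idx), T (σ μ) (σ ν) (σ lam) (σ ρ) = T μ ν lam ρ

/-- [our object] Invariance of a quartic table under axis reflections (each vector index along the reflected axis flips sign). -/
def FlipInvariant₄ (T : QuarticTable) : Prop :=
  ∀ (α μ ν lam ρ : Idx), rs α μ * rs α ν * rs α lam * rs α ρ * T μ ν lam ρ = T μ ν lam ρ

/-- [our object] The hypercubic tensor `[μ = ν = λ = ρ]`, written with Kronecker deltas. -/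
def allEq (μ ν lam ρ : Idx) : ℝ := δ μ ν * δ ν lam * δ lam ρ

/-- [our object] Collapse of a Kronecker-delta sum, `Σ_ν δ_{μν} g ν = g μ`. -/
theorem sum_δ_mul (μ : Idx) (g : Idx → ℝ) : ∑ ν, δ μ ν * g ν = g μ := by
  simp only [δ, ite_mul, one_mul, zero_mul, Finset.sum_ite_eq, Finset.mem_univ, if_true]

/-! ## 1. Classification of `B₄`-invariant quartic Lorentz tables -/

section Classification
variable {T : QuarticTable}

/-- [our object] REFLECTION KILL: if flipping axis `α` changes the sign of the monomial (product of the four signs `= −1`), the coefficient vanishes. -/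
theorem eq_zero_of_flip₄ (hF : FlipInvariant₄ T) (α : Idx) {μ ν lam ρ : Idx}
    (hs : rs α μ * rs α ν * rs α lam * rs α ρ = -1) : T μ ν lam ρ = 0 := by
  have h := hF α μ ν lam ρ
  rw [hs] at h
  linarith

/-- [our object] PATTERN TRANSPORT `(0,0,1,1) ↦ (μ,μ,λ,λ)`. -/
theorem val₄_aabb (hP : PermInvariant₄ T) {μ lam : Idx} (h : μ ≠ lam) : T μ μ lam lam = T 0 0 1 1 := by
  obtain ⟨σ, h0, h1⟩ := exists_perm_zero_one h
  simpa [h0, h1] using hP σ 0 0 1 1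

/-- [our object] PATTERN TRANSPORT `(0,1,0,1) ↦ (μ,ν,μ,ν)`. -/
theorem val₄_abab (hP : PermInvariant₄ T) {μ ν : Idx} (h : μ ≠ ν) : T μ ν μ ν = T 0 1 0 1 := by
  obtain ⟨σ, h0, h1⟩ := exists_perm_zero_one h
  simpa [h0, h1] using hP σ 0 1 0 1

/-- [our object] PATTERN TRANSPORT `(0,1,1,0) ↦ (μ,ν,ν,μ)`. -/
theorem val₄_abba (hP : PermInvariant₄ T) {μ ν : Idx} (h : μ ≠ ν) : T μ ν ν μ = T 0 1 1 0 := by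
  obtain ⟨σ, h0, h1⟩ := exists_perm_zero_one h
  simpa [h0, h1] using hP σ 0 1 1 0

/-- [our object] PATTERN TRANSPORT `(0,0,0,0) ↦ (μ,μ,μ,μ)`. -/
theorem val₄_aaaa (hP : PermInvariant₄ T) (μ : Idx) : T μ μ μ μ = T 0 0 0 0 := by
  obtain ⟨σ, h0⟩ := exists_perm_zero μ
  simpa [h0] using hP σ 0 0 0 0

/-- [our object] **CLASSIFICATION OF HYPEROCTAHEDRAL QUARTIC INVARIANTS**: a `B₄`-invariant quartic Lorentz table lies in the span of the three pairings
`δ_{μν}δ_{λρ}`, `δ_{μλ}δ_{νρ}`, `δ_{μρ}δ_{νλ}` and the hypercubic tensor `[μ=ν=λ=ρ]`, with the displayed coefficients (an index of odd multiplicity is killed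
by the reflection of its axis; the even patterns are transported to `(0,0,1,1)`, `(0,1,0,1)`, `(0,1,1,0)`, `(0,0,0,0)` by a permutation). -/
theorem quartic_classification (hP : PermInvariant₄ T) (hF : FlipInvariant₄ T) (μ ν lam ρ : Idx) :
    T μ ν lam ρ = T 0 0 1 1 * (δ μ ν * δ lam ρ) + T 0 1 0 1 * (δ μ lam * δ ν ρ) + T 0 1 1 0 * (δ μ ρ * δ ν lam)
      + (T 0 0 0 0 - T 0 0 1 1 - T 0 1 0 1 - T 0 1 1 0) * allEq μ ν lam ρ := by
  unfold allEq
  by_cases hmn : μ = ν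
  · subst hmn
    by_cases hlr : lam = ρ
    · subst hlr
      by_cases hml : μ = lam
      · subst hml
        rw [val₄_aaaa hP μ]; simp
      · rw [val₄_aabb hP hml]; simp [δ_of_ne hml]
    · by_cases hml : μ = lam
      · subst hml
        rw [eq_zero_of_flip₄ hF ρ (by rw [rs_of_ne hlr, rs_self]; norm_num)]
        simp [δ_of_ne hlr]
      · by_cases hmr : μ = ρ
        · subst hmr
          rw [eq_zero_of_flip₄ hF lam (by rw [rs_of_ne hml, rs_self]; norm_num)]
          simp [δ_of_ne hml, δ_of_ne hlr]
        · rw [eq_zero_of_flip₄ hF lam (by rw [rs_of_ne hml, rs_self, rs_of_ne (Ne.symm hlr)]; norm_num)]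
          simp [δ_of_ne hml, δ_of_ne hlr, δ_of_ne hmr]
  · by_cases hml : μ = lam
    · subst hml
      by_cases hnr : ν = ρ
      · subst hnr
        rw [val₄_abab hP hmn]; simp [δ_of_ne hmn, δ_of_ne (Ne.symm hmn)]
      · rw [eq_zero_of_flip₄ hF ν (by rw [rs_of_ne hmn, rs_self, rs_of_ne (Ne.symm hnr)]; norm_num)]
        simp [δ_of_ne hmn, δ_of_ne (Ne.symm hmn), δ_of_ne hnr]
    · by_cases hmr : μ = ρ
      · subst hmr
        by_cases hnl : ν = lam
        · subst hnl
          rw [val₄_abba hP hmn]; simp [δ_of_ne hmn]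
        · rw [eq_zero_of_flip₄ hF ν (by rw [rs_of_ne hmn, rs_self, rs_of_ne (Ne.symm hnl)]; norm_num)]
          simp [δ_of_ne hmn, δ_of_ne hml, δ_of_ne hnl]
      · rw [eq_zero_of_flip₄ hF μ (by
            rw [rs_self, rs_of_ne (Ne.symm hmn), rs_of_ne (Ne.symm hml), rs_of_ne (Ne.symm hmr)]; norm_num)]
        simp [δ_of_ne hmn, δ_of_ne hml, δ_of_ne hmr]

end Classification

/-! ## 2. The four basis tensors against a 4-ary table, and the three channel forms -/

section Channels
/-- [our object] Contraction with the pairing `δ_{μν}δ_{λρ}`. -/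
theorem sum_pair12 (G : Idx → Idx → Idx → Idx → ℝ) (A : ℝ) :
    ∑ μ, ∑ ν, ∑ lam, ∑ ρ, A * (δ μ ν * δ lam ρ) * G μ ν lam ρ = A * ∑ μ, ∑ lam, G μ μ lam lam := by
  rw [show (∑ μ, ∑ ν, ∑ lam, ∑ ρ, A * (δ μ ν * δ lam ρ) * G μ ν lam ρ) = ∑ μ, ∑ ν, δ μ ν * ∑ lam, ∑ ρ, δ lam ρ * (A * G μ ν lam ρ) by
    simp only [Finset.mul_sum]
    exact sum_congr rfl fun _ _ => sum_congr rfl fun _ _ => sum_congr rfl fun _ _ => sum_congr rfl fun _ _ => by ring]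
  simp only [sum_δ_mul]; simp only [Finset.mul_sum]

/-- [our object] Contraction with the pairing `δ_{μλ}δ_{νρ}`. -/
theorem sum_pair13 (G : Idx → Idx → Idx → Idx → ℝ) (A : ℝ) :
    ∑ μ, ∑ ν, ∑ lam, ∑ ρ, A * (δ μ lam * δ ν ρ) * G μ ν lam ρ = A * ∑ μ, ∑ ν, G μ ν μ ν := by
  rw [show (∑ μ, ∑ ν, ∑ lam, ∑ ρ, A * (δ μ lam * δ ν ρ) * G μ ν lam ρ) = ∑ μ, ∑ ν, ∑ lam, δ μ lam * ∑ ρ, δ ν ρ * (A * G μ ν lam ρ) by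
    simp only [Finset.mul_sum]
    exact sum_congr rfl fun _ _ => sum_congr rfl fun _ _ => sum_congr rfl fun _ _ => sum_congr rfl fun _ _ => by ring]
  simp only [sum_δ_mul]; simp only [Finset.mul_sum]

/-- [our object] Contraction with the pairing `δ_{μρ}δ_{νλ}`. -/
theorem sum_pair14 (G : Idx → Idx → Idx → Idx → ℝ) (A : ℝ) :
    ∑ μ, ∑ ν, ∑ lam, ∑ ρ, A * (δ μ ρ * δ ν lam) * G μ ν lam ρ = A * ∑ μ, ∑ ν, G μ ν ν μ := by
  rw [show (∑ μ, ∑ ν, ∑ lam, ∑ ρ, A * (δ μ ρ * δ ν lam) * G μ ν lam ρ) = ∑ μ, ∑ ν, ∑ lam, δ ν lam * ∑ ρ, δ μ ρ * (A * G μ ν lam ρ) by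
    simp only [Finset.mul_sum]
    exact sum_congr rfl fun _ _ => sum_congr rfl fun _ _ => sum_congr rfl fun _ _ => sum_congr rfl fun _ _ => by ring]
  simp only [sum_δ_mul]; simp only [Finset.mul_sum]

/-- [our object] Contraction with the hypercubic tensor `[μ=ν=λ=ρ]`. -/
theorem sum_allEq (G : Idx → Idx → Idx → Idx → ℝ) (A : ℝ) :
    ∑ μ, ∑ ν, ∑ lam, ∑ ρ, A * allEq μ ν lam ρ * G μ ν lam ρ = A * ∑ μ, G μ μ μ μ := by
  rw [show (∑ μ, ∑ ν, ∑ lam, ∑ ρ, A * allEq μ ν lam ρ * G μ ν lam ρ) = ∑ μ, ∑ ν, δ μ ν * ∑ lam, δ ν lam * ∑ ρ, δ lam ρ * (A * G μ ν lam ρ) by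
    simp only [Finset.mul_sum, allEq]
    exact sum_congr rfl fun _ _ => sum_congr rfl fun _ _ => sum_congr rfl fun _ _ => sum_congr rfl fun _ _ => by ring]
  simp only [sum_δ_mul]; simp only [Finset.mul_sum]

/-- [our object] GENERIC EVALUATION: a `B₄`-invariant table against ANY 4-ary table `G` is the displayed combination of four traces of `G`. -/
theorem sum_table_eq {T : QuarticTable} (hP : PermInvariant₄ T) (hF : FlipInvariant₄ T) (G : Idx → Idx → Idx → Idx → ℝ) :
    ∑ μ, ∑ ν, ∑ lam, ∑ ρ, T μ ν lam ρ * G μ ν lam ρ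
      = T 0 0 1 1 * (∑ μ, ∑ lam, G μ μ lam lam) + T 0 1 0 1 * (∑ μ, ∑ ν, G μ ν μ ν) + T 0 1 1 0 * (∑ μ, ∑ ν, G μ ν ν μ)
        + (T 0 0 0 0 - T 0 0 1 1 - T 0 1 0 1 - T 0 1 1 0) * ∑ μ, G μ μ μ μ := by
  have hT : ∀ μ ν lam ρ, T μ ν lam ρ * G μ ν lam ρ
      = T 0 0 1 1 * (δ μ ν * δ lam ρ) * G μ ν lam ρ + T 0 1 0 1 * (δ μ lam * δ ν ρ) * G μ ν lam ρ
        + T 0 1 1 0 * (δ μ ρ * δ ν lam) * G μ ν lam ρ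
        + (T 0 0 0 0 - T 0 0 1 1 - T 0 1 0 1 - T 0 1 1 0) * allEq μ ν lam ρ * G μ ν lam ρ := by
    intro μ ν lam ρ
    rw [quartic_classification hP hF μ ν lam ρ]
    ring
  simp only [hT, Finset.sum_add_distrib, sum_pair12, sum_pair13, sum_pair14, sum_allEq]

variable {C : Type*} [Fintype C]

/-- [our object] The `s`-channel form of a table `T` against currents `S e μ ν` (colour pairing `(12)(34)`): `Σ_{μνλρ} T μνλρ Σ_e S e μ ν·S e λ ρ`. -/
def chanS (T : QuarticTable) (S : C → Idx → Idx → ℝ) : ℝ :=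
  ∑ μ, ∑ ν, ∑ lam, ∑ ρ, T μ ν lam ρ * ∑ e, S e μ ν * S e lam ρ

/-- [our object] The `t`-channel form (colour pairing `(13)(24)`): `Σ_{μνλρ} T μνλρ Σ_e S e μ λ·S e ν ρ`. -/
def chanT (T : QuarticTable) (S : C → Idx → Idx → ℝ) : ℝ :=
  ∑ μ, ∑ ν, ∑ lam, ∑ ρ, T μ ν lam ρ * ∑ e, S e μ lam * S e ν ρ

/-- [our object] The `u`-channel form (colour pairing `(14)(23)`): `Σ_{μνλρ} T μνλρ Σ_e S e μ ρ·S e ν λ`. -/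
def chanU (T : QuarticTable) (S : C → Idx → Idx → ℝ) : ℝ :=
  ∑ μ, ∑ ν, ∑ lam, ∑ ρ, T μ ν lam ρ * ∑ e, S e μ ρ * S e ν lam

/-- [our object] The Yang–Mills quadratic form of a family of currents: `ym S = Σ_μ Σ_ν Σ_e (S e μ ν)²`. -/
def ym (S : C → Idx → Idx → ℝ) : ℝ := ∑ μ, ∑ ν, ∑ e, S e μ ν ^ 2

variable {S : C → Idx → Idx → ℝ}

omit [Fintype C] in
/-- [our object] For currents antisymmetric in `(μ,ν)` the diagonal vanishes. -/
theorem diag_eq_zero (hS : ∀ e μ ν, S e ν μ = -S e μ ν) (e : C) (μ : Idx) : S e μ μ = 0 := by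
  have := hS e μ μ
  linarith

/-- [our object] The crossed trace of antisymmetric currents is minus the Yang–Mills density. -/
theorem sum_cross (hS : ∀ e μ ν, S e ν μ = -S e μ ν) (μ ν : Idx) : ∑ e, S e μ ν * S e ν μ = -∑ e, S e μ ν ^ 2 := by
  rw [← Finset.sum_neg_distrib]
  exact sum_congr rfl fun e _ => by rw [hS e μ ν]; ring

/-- [our object] The straight trace is the Yang–Mills density. -/
theorem sum_sq (S : C → Idx → Idx → ℝ) (μ ν : Idx) : ∑ e, S e μ ν * S e μ ν = ∑ e, S e μ ν ^ 2 :=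
  sum_congr rfl fun e _ => by ring

/-- [our object] **THE `s`-CHANNEL FORM** of a `B₄`-invariant table against antisymmetric currents: `chanS T S = (T₀₁₀₁ − T₀₁₁₀)·ym S`. -/
theorem chanS_eq {T : QuarticTable} (hP : PermInvariant₄ T) (hF : FlipInvariant₄ T) (hS : ∀ e μ ν, S e ν μ = -S e μ ν) :
    chanS T S = (T 0 1 0 1 - T 0 1 1 0) * ym S := by
  unfold chanS ym
  rw [sum_table_eq hP hF]
  simp only [diag_eq_zero hS, mul_zero, Finset.sum_const_zero, sum_sq, sum_cross hS, Finset.sum_neg_distrib]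
  ring

/-- [our object] **THE `t`-CHANNEL FORM**: `chanT T S = (T₀₀₁₁ − T₀₁₁₀)·ym S`. -/
theorem chanT_eq {T : QuarticTable} (hP : PermInvariant₄ T) (hF : FlipInvariant₄ T) (hS : ∀ e μ ν, S e ν μ = -S e μ ν) :
    chanT T S = (T 0 0 1 1 - T 0 1 1 0) * ym S := by
  unfold chanT ym
  rw [sum_table_eq hP hF (fun μ ν lam ρ => ∑ e, S e μ lam * S e ν ρ)]
  simp only [diag_eq_zero hS, mul_zero, Finset.sum_const_zero, sum_sq, sum_cross hS, Finset.sum_neg_distrib]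
  ring

/-- [our object] **THE `u`-CHANNEL FORM**: `chanU T S = (T₀₀₁₁ − T₀₁₀₁)·ym S`. -/
theorem chanU_eq {T : QuarticTable} (hP : PermInvariant₄ T) (hF : FlipInvariant₄ T) (hS : ∀ e μ ν, S e ν μ = -S e μ ν) :
    chanU T S = (T 0 0 1 1 - T 0 1 0 1) * ym S := by
  unfold chanU ym
  rw [sum_table_eq hP hF (fun μ ν lam ρ => ∑ e, S e μ ρ * S e ν lam)]
  simp only [diag_eq_zero hS, mul_zero, Finset.sum_const_zero, sum_sq, sum_cross hS, Finset.sum_neg_distrib]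
  ring

end Channels

/-! ## 3. Colour: the vertex, its value on a background, the currents, and the colour Fubini -/

section Colour
variable {C : Type*} [Fintype C]

/-- [our object] Antisymmetry of the colour table in its first two slots (the only property of the structure constants that is used). -/
def Antisym (f : C → C → C → ℝ) : Prop := ∀ a b e, f b a e = -f a b e

/-- [our object] **The quartic vertex** with colour structure in the channel span, legs `(a,μ),(b,ν),(c,λ),(d,ρ)`:
`V^{abcd}_{μνλρ} = (Σ_e f_{abe}f_{cde})·Q 0 μνλρ + (Σ_e f_{ace}f_{bde})·Q 1 μνλρ + (Σ_e f_{ade}f_{bce})·Q 2 μνλρ`. -/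
def vertex (f : C → C → C → ℝ) (Q : Fin 3 → QuarticTable) (a b c d : C) (μ ν lam ρ : Idx) : ℝ :=
  (∑ e, f a b e * f c d e) * Q 0 μ ν lam ρ + (∑ e, f a c e * f b d e) * Q 1 μ ν lam ρ
    + (∑ e, f a d e * f b c e) * Q 2 μ ν lam ρ

/-- [our object] **The value of the quartic vertex on a background** `B : C → Idx → ℝ`: `Σ_{μνλρ} Σ_{abcd} V^{abcd}_{μνλρ}·B a μ·B b ν·B c λ·B d ρ`. -/
def quarticPoly (f : C → C → C → ℝ) (Q : Fin 3 → QuarticTable) (B : C → Idx → ℝ) : ℝ :=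
  ∑ μ, ∑ ν, ∑ lam, ∑ ρ, ∑ a, ∑ b, ∑ c, ∑ d, vertex f Q a b c d μ ν lam ρ * (B a μ * B b ν * B c lam * B d ρ)

/-- [our object] The currents of a background: `cur f B e μ ν = Σ_{ab} f_{abe}·B a μ·B b ν` (`= [B_μ, B_ν]^e` for structure constants `f`). -/
def cur (f : C → C → C → ℝ) (B : C → Idx → ℝ) (e : C) (μ ν : Idx) : ℝ := ∑ a, ∑ b, f a b e * (B a μ * B b ν)

/-- [our object] **The Yang–Mills quartic germ** on a background: `Σ_μ Σ_ν Σ_e (Σ_{ab} f_{abe} B a μ B b ν)²` (`= Σ_{μν} |[B_μ,B_ν]|²`). -/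
def ymQuartic (f : C → C → C → ℝ) (B : C → Idx → ℝ) : ℝ := ym (cur f B)

/-- [our object] The coefficient: `cQ Q = (Q 0)₀₁₀₁ − (Q 0)₀₁₁₀ + (Q 1)₀₀₁₁ − (Q 1)₀₁₁₀ + (Q 2)₀₀₁₁ − (Q 2)₀₁₀₁`. -/
def cQ (Q : Fin 3 → QuarticTable) : ℝ :=
  (Q 0 0 1 0 1 - Q 0 0 1 1 0) + (Q 1 0 0 1 1 - Q 1 0 1 1 0) + (Q 2 0 0 1 1 - Q 2 0 1 0 1)

/-- [our object] The currents of an antisymmetric colour table are antisymmetric in `(μ,ν)`. -/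
theorem cur_antisym {f : C → C → C → ℝ} (hf : Antisym f) (B : C → Idx → ℝ) (e : C) (μ ν : Idx) :
    cur f B e ν μ = -cur f B e μ ν := by
  unfold cur
  rw [Finset.sum_comm, ← Finset.sum_neg_distrib]
  refine sum_congr rfl fun a _ => ?_
  rw [← Finset.sum_neg_distrib]
  exact sum_congr rfl fun b _ => by rw [hf a b e]; ring

/-- [our object] Moving a fifth (innermost) finite sum outermost. -/
theorem sum_rot5 {α β γ γ' ε : Type*} [Fintype α] [Fintype β] [Fintype γ] [Fintype γ'] [Fintype ε]
    (F : α → β → γ → γ' → ε → ℝ) :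
    ∑ a, ∑ b, ∑ c, ∑ d, ∑ e, F a b c d e = ∑ e, ∑ a, ∑ b, ∑ c, ∑ d, F a b c d e := by
  have h4 : ∀ a b c, ∑ d, ∑ e, F a b c d e = ∑ e, ∑ d, F a b c d e := fun a b c => Finset.sum_comm
  have h3 : ∀ a b, ∑ c, ∑ d, ∑ e, F a b c d e = ∑ e, ∑ c, ∑ d, F a b c d e := fun a b => by
    rw [sum_congr rfl fun c _ => h4 a b c]; exact Finset.sum_comm
  have h2 : ∀ a, ∑ b, ∑ c, ∑ d, ∑ e, F a b c d e = ∑ e, ∑ b, ∑ c, ∑ d, F a b c d e := fun a => by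
    rw [sum_congr rfl fun b _ => h3 a b]; exact Finset.sum_comm
  rw [sum_congr rfl fun a _ => h2 a]; exact Finset.sum_comm

/-- [our object] Colour Fubini, `s`-channel: `Σ_{abcd} (Σ_e f_{abe}f_{cde})·t·u_a v_b w_c z_d = t·Σ_e (Σ_{ab} f_{abe}u_a v_b)(Σ_{cd} f_{cde}w_c z_d)`. -/
theorem fubini_s (f : C → C → C → ℝ) (t : ℝ) (u v w z : C → ℝ) :
    ∑ a, ∑ b, ∑ c, ∑ d, (∑ e, f a b e * f c d e) * t * (u a * v b * w c * z d)
      = t * ∑ e, (∑ a, ∑ b, f a b e * (u a * v b)) * (∑ c, ∑ d, f c d e * (w c * z d)) := by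
  have hR : ∀ e, (∑ a, ∑ b, f a b e * (u a * v b)) * (∑ c, ∑ d, f c d e * (w c * z d))
      = ∑ a, ∑ b, ∑ c, ∑ d, f a b e * (u a * v b) * (f c d e * (w c * z d)) := by
    intro e
    simp_rw [Finset.sum_mul]
    simp_rw [Finset.mul_sum]
  simp only [hR, Finset.mul_sum, Finset.sum_mul]
  rw [sum_rot5]
  exact sum_congr rfl fun _ _ => sum_congr rfl fun _ _ => sum_congr rfl fun _ _ => sum_congr rfl fun _ _ => sum_congr rfl fun _ _ => by ring

/-- [our object] Colour Fubini, `t`-channel: `Σ_{abcd} (Σ_e f_{ace}f_{bde})·t·u_a v_b w_c z_d = t·Σ_e (Σ_{ac} f_{ace}u_a w_c)(Σ_{bd} f_{bde}v_b z_d)`. -/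
theorem fubini_t (f : C → C → C → ℝ) (t : ℝ) (u v w z : C → ℝ) :
    ∑ a, ∑ b, ∑ c, ∑ d, (∑ e, f a c e * f b d e) * t * (u a * v b * w c * z d)
      = t * ∑ e, (∑ a, ∑ c, f a c e * (u a * w c)) * (∑ b, ∑ d, f b d e * (v b * z d)) := by
  have hR : ∀ e, (∑ a, ∑ c, f a c e * (u a * w c)) * (∑ b, ∑ d, f b d e * (v b * z d))
      = ∑ a, ∑ b, ∑ c, ∑ d, f a c e * (u a * w c) * (f b d e * (v b * z d)) := fun e => by
    simp only [Finset.sum_mul_sum]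
  simp only [hR, Finset.mul_sum, Finset.sum_mul]
  rw [sum_rot5]
  exact sum_congr rfl fun _ _ => sum_congr rfl fun _ _ => sum_congr rfl fun _ _ => sum_congr rfl fun _ _ => sum_congr rfl fun _ _ => by ring

/-- [our object] Colour Fubini, `u`-channel: `Σ_{abcd} (Σ_e f_{ade}f_{bce})·t·u_a v_b w_c z_d = t·Σ_e (Σ_{ad} f_{ade}u_a z_d)(Σ_{bc} f_{bce}v_b w_c)`. -/
theorem fubini_u (f : C → C → C → ℝ) (t : ℝ) (u v w z : C → ℝ) :
    ∑ a, ∑ b, ∑ c, ∑ d, (∑ e, f a d e * f b c e) * t * (u a * v b * w c * z d)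
      = t * ∑ e, (∑ a, ∑ d, f a d e * (u a * z d)) * (∑ b, ∑ c, f b c e * (v b * w c)) := by
  have hR : ∀ e, (∑ a, ∑ d, f a d e * (u a * z d)) * (∑ b, ∑ c, f b c e * (v b * w c))
      = ∑ a, ∑ b, ∑ c, ∑ d, f a d e * (u a * z d) * (f b c e * (v b * w c)) := fun e => by
    simp only [Finset.sum_mul_sum]
    exact sum_congr rfl fun a _ => sum_congr rfl fun b _ => Finset.sum_comm
  simp only [hR, Finset.mul_sum, Finset.sum_mul]
  rw [sum_rot5]
  exact sum_congr rfl fun _ _ => sum_congr rfl fun _ _ => sum_congr rfl fun _ _ => sum_congr rfl fun _ _ => sum_congr rfl fun _ _ => by ring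

/-- [our object] **COLOUR FUBINI**: the value of the vertex on a background is the sum of the three channel forms of its Lorentz tables against the
background's currents. -/
theorem quarticPoly_eq_channels (f : C → C → C → ℝ) (Q : Fin 3 → QuarticTable) (B : C → Idx → ℝ) :
    quarticPoly f Q B = chanS (Q 0) (cur f B) + chanT (Q 1) (cur f B) + chanU (Q 2) (cur f B) := by
  unfold quarticPoly chanS chanT chanU
  simp only [← Finset.sum_add_distrib]
  refine sum_congr rfl fun μ _ => sum_congr rfl fun ν _ => sum_congr rfl fun lam _ => sum_congr rfl fun ρ _ => ?_
  simp only [vertex, add_mul, Finset.sum_add_distrib, cur]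
  rw [fubini_s, fubini_t, fubini_u]

end Colour

/-! ## 4. THE UNIQUENESS THEOREM, the consistency check, and the necessity of the colour hypothesis -/

section Main
variable {C : Type*} [Fintype C] {f : C → C → C → ℝ} {Q : Fin 3 → QuarticTable}

/-- [our object] **UNIQUENESS OF THE MARGINAL QUARTIC GAUGE VERTEX UNDER HYPEROCTAHEDRAL SYMMETRY.**  A momentum-free quartic vertex whose colour
structure lies in the span of the channel tensors `f^{abe}f^{cde}`, `f^{ace}f^{bde}`, `f^{ade}f^{bce}` (`f` antisymmetric in its first two slots)
and whose three Lorentz tables are invariant under the signed permutations of the four axes takes, on EVERY background `B`, the value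
`cQ Q · Σ_{μν} Σ_e ([B_μ,B_ν]^e)²` — a multiple of the Yang–Mills quartic germ, ONE free scale; the hypercubic-but-not-`O(4)` invariant has weight
zero in every channel.  Neither total antisymmetry of `f`, nor the Jacobi identity, nor Bose symmetry of the tables is used. -/
theorem quartic_unique (hf : Antisym f) (hP : ∀ k, PermInvariant₄ (Q k)) (hF : ∀ k, FlipInvariant₄ (Q k)) (B : C → Idx → ℝ) :
    quarticPoly f Q B = cQ Q * ymQuartic f B := by
  rw [quarticPoly_eq_channels, chanS_eq (hP 0) (hF 0) (cur_antisym hf B), chanT_eq (hP 1) (hF 1) (cur_antisym hf B),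
    chanU_eq (hP 2) (hF 2) (cur_antisym hf B), ymQuartic, cQ]
  ring

/-- [our object] The Yang–Mills vertex's own Lorentz tables: `s`-channel `δ_{μλ}δ_{νρ}`, nothing in the `t`/`u` channels
(`Σ f_{abe}f_{cde} B a μ·B b ν·B c μ·B d ν = Σ_{μν} Σ_e ([B_μ,B_ν]^e)²`). -/
def ymTable : Fin 3 → QuarticTable := fun k μ ν lam ρ => if k = 0 then δ μ lam * δ ν ρ else 0

/-- [our object] `ymTable` is invariant under axis permutations. -/
theorem ymTable_permInvariant (k : Fin 3) : PermInvariant₄ (ymTable k) := by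
  intro σ μ ν lam ρ
  simp only [ymTable, δ_perm]

/-- [our object] `ymTable` is invariant under axis reflections (`rs α μ² = 1`). -/
theorem ymTable_flipInvariant (k : Fin 3) : FlipInvariant₄ (ymTable k) := by
  intro α μ ν lam ρ
  simp only [ymTable, rs, δ]
  split_ifs <;> simp_all

/-- [our object] CONSISTENCY CHECK: the Yang–Mills tables have `cQ = 1`, so `quarticPoly f ymTable B = ymQuartic f B` — the encoding returns the
Yang–Mills germ on the Yang–Mills vertex. -/
theorem quarticPoly_ymTable (hf : Antisym f) (B : C → Idx → ℝ) : quarticPoly f ymTable B = ymQuartic f B := by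
  have hc : cQ ymTable = 1 := by simp [cQ, ymTable, δ]
  rw [quartic_unique hf ymTable_permInvariant ymTable_flipInvariant B, hc, one_mul]

end Main

section Necessity
/-- [our object] The hypercubic colour-singlet quartic `Σ_μ (Σ_a (B a μ)²)²` (colour `δ^{ab}δ^{cd}` ⊗ Lorentz `[μ=ν=λ=ρ]`: `B₄`-invariant, Bose-symmetric). -/
def hypercubicSinglet {C : Type*} [Fintype C] (B : C → Idx → ℝ) : ℝ := ∑ μ, (∑ a, B a μ ^ 2) ^ 2

/-- [our object] **NECESSITY OF THE COLOUR HYPOTHESIS.**  Hyperoctahedral invariance ALONE does not force the Yang–Mills form at quartic order: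
with one colour (`C = Unit`; an antisymmetric `f` vanishes there) the constant background `B ≡ 1` has `ymQuartic f B = 0` but `hypercubicSinglet B = 4`,
so it is `c · ymQuartic f` for no `c` (hence, by `quartic_unique`, the value of no vertex of the channel span). -/
theorem hypercubic_singlet_not_ym (f : Unit → Unit → Unit → ℝ) (hf : Antisym f) :
    ¬ ∃ c : ℝ, ∀ B : Unit → Idx → ℝ, hypercubicSinglet B = c * ymQuartic f B := by
  rintro ⟨c, hc⟩
  have hf0 : f () () () = 0 := by have := hf () () (); linarith
  have h := hc (fun _ _ => 1)
  have hym : ymQuartic f (fun _ _ => (1 : ℝ)) = 0 := by simp [ymQuartic, ym, cur, hf0]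
  have h4 : hypercubicSinglet (fun (_ : Unit) (_ : Idx) => (1 : ℝ)) = 4 := by
    simp [hypercubicSinglet, Finset.sum_const, Finset.card_univ, Fintype.card_fin]
  rw [hym, mul_zero, h4] at h
  norm_num at h

end Necessity

end Summit.QuantumFields.BalabanUV.Beta.FP.MarginalUniquenessQuartic
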